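import Mathlib
import HarnessLib
import Summits.NavierStokesRegularity.NavierStokesRegularity.Theorems.PoloidalWindowDoorPoloidalWindowRigidityK2OfLrcSlope
import Summits.NavierStokesRegularity.NavierStokesRegularity.Theorems.PoloidalWindowDoorPoloidalWindowRigiditySymmetryGerms
import Summits.NavierStokesRegularity.NavierStokesRegularity.Theorems.PoloidalWindowDoorPoloidalWindowRigidityVerticalShearGerm

/-!
# Route `PoloidalWindowDoor`, crux `PoloidalWindowRigidity` (K2, stmt-NavierStokesRegularity-19708) — line «lrc-jet»: the
# complement of SPATIAL pins `∇Λ ≠ 0` — REDUCTION OF «LOCALLY TIME-ONLY SLOPE» TO TIME-DEPENDENT PROPORTIONAL SHEAR ON EVERY SLICE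

Cell ns-regularity-ideate, seat ns-poloidal-K2-p3 gen 4 (stub-worker under the K2 lead ns-poloidal-K2-p1; file landed
`--supports stmt-NavierStokesRegularity-19708` as a helper).

DIRECTOR-NS #21 restates the line's research stub as LRC″ with the extra pin «`∇Λ ≠ 0`».  If that pin is the SPATIAL
gradient of the slope (as in the lead's jet probes, K2P1-LOCAL-NOTES v4), the assembly `K2 ⇐ LRC″` must dispose of the
complement inside the non-degenerate set: «on some nonempty open space–time set the shear slope is a function of TIME ONLY»,
`∂₂v_b(s,y) = m(s) ∂_b v₂(s,y)` (`b = 0,1`).  This file reduces that complement to ONE sharply stated stratum: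

* `slice_const_of_proportionalShear_pos`, `eq_zero_of_proportionalShear_slice_pos` — ONE slice with proportional shear of
  POSITIVE slope `μ > 0` (poloidal, bounded, `C²`, divergence-free) is constant (ns-poloidal-K2-p1's anisotropic rescaling,
  p463086, run on a single slice), hence the profile vanishes (nsreg-p7's flat germ `eq_zero_of_fderiv_apply_eq_zero_on_open`).
* `shearMinor_eq_zero_of_local` — **propagation by joint analyticity in `(s, y, y′)`**: if the slope is time-only on a
  nonempty open space–time set, then on EVERY slice `s < 0` all the `2 × 2` minors
  `∂₂v_b(s,y) ∂_{b′}v₂(s,y′) − ∂₂v_{b′}(s,y′) ∂_b v₂(s,y)` (`b, b′ ∈ {0,1}`, all `y, y′ ∈ ℝ³`) vanish.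
* `proportionalShear_or_flat_of_minor` — pointwise algebra: vanishing minors on a slice ⇒ the slice is horizontally flat
  (`∇_h v₂ ≡ 0`) or proportional-shear with ONE slope `μ`.
* `timeShear_of_local` — **THE REDUCTION**: class + poloidal + time-only slope on some nonempty open space–time set ⇒
  EITHER `v ≡ 0` OR every slice `s < 0` is proportional-shear with its own NEGATIVE slope, `∂₂v_b(s,·) ≡ μ_s ∂_b v₂(s,·)`,
  `μ_s < 0` (flat slices, `μ_s = 0` = nsreg-p7's vertically rigid germ p509770, and `μ_s > 0` are excluded on the way).
* `analyticAt_sliceSlope` — in the second case the slope function is real-analytic in `s` near every slice carrying a point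
  with `∂_b v₂ ≠ 0` (it is the ratio `∂₂v_b(s,y₀)/∂_b v₂(s,y₀)` there).
* `nonflatLiouville_of_local_timeShear_of_const` — if the slopes `μ_s` of the second case are one constant, K2-p2's
  p511024 (via `…K2OfLrcSlope.nonflatLiouville_of_constantShear_real`) ends.

LOCATED RESIDUAL (for the K2 lead / ns-poloidal-K2-p2): the stratum (TV) «every slice `s < 0` proportional-shear with slope
`μ_s < 0`, `s ↦ μ_s` NOT constant» is not settled in the tree.  On it the pressure is NOT separated —
`∂₂p = (h′(s,x₂) − μ′(s) v₂)/(1 − μ(s))` — so p511024's mechanism M12 needs the extra term `2μ′/(1−μ)·V` in the variance law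
(equivalently: run it on the Clebsch stream function `ψ = (1 − μ(s)) v₂`, whose horizontal gradient is the vorticity).

WHAT THIS IS NOT: not a claim about Navier–Stokes regularity and not LRC″ — a reduction of one complementary case of a
proposed line to a named stratum (bears_on LADDER-NS N0 via crux K2 = stmt-19708).
-/

noncomputable section

-- the summit and its single sub-problem share the name (CONVENTIONS §1), as in every Theorems file
set_option linter.dupNamespace false

namespace Summit.NavierStokesRegularity.NavierStokesRegularity.Theorems.PoloidalWindowDoorPoloidalWindowRigidityTimeShear

open Set Function Filter Topology Metric
open scoped RealInnerProductSpace InnerProductSpace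
open Literature.Analysis Literature.Analysis.FluidPDE
open Summit.NavierStokesRegularity.NavierStokesRegularity.Theorems.LocalSineTubeDoorProfileAlignedWindowRigidityAncient
open Summit.NavierStokesRegularity.NavierStokesRegularity.Theorems.TubeAlternative.AnalyticPropagation
open Summit.NavierStokesRegularity.NavierStokesRegularity.Theorems.PoloidalWindowDoorPoloidalWindowRigidityProportionalShear
open Summit.NavierStokesRegularity.NavierStokesRegularity.Theorems.PoloidalWindowDoorPoloidalWindowRigiditySymmetryGerms
open Summit.NavierStokesRegularity.NavierStokesRegularity.Theorems.PoloidalWindowDoorPoloidalWindowRigidityVerticalShearGerm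
open Summit.NavierStokesRegularity.NavierStokesRegularity.Theorems.PoloidalWindowDoorPoloidalWindowRigidityK2OfLrcSlope
open Summit.NavierStokesRegularity.NavierStokesRegularity.Theorems.PoloidalWindowDoorPoloidalWindowRigidityFlat

variable {C : ℝ} {v : ℝ → EuclideanSpace ℝ (Fin 3) → EuclideanSpace ℝ (Fin 3)}

/-! ### One slice with positive slope -/

/-- **A poloidal, bounded, divergence-free `C²` slice with proportional shear of POSITIVE slope is constant** (the
anisotropic rescaling of ns-poloidal-K2-p1's `eq_zero_of_proportionalShear`, p463086, on ONE slice: the rescaled field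
`D_c ∘ V ∘ D_{c⁻¹}`, `c = √μ`, is curl-free, divergence-free and bounded, hence constant by the tree's div–curl Liouville
theorem). -/
theorem slice_const_of_proportionalShear_pos {V : EuclideanSpace ℝ (Fin 3) → EuclideanSpace ℝ (Fin 3)}
    (hV2 : ContDiff ℝ 2 V) {B : ℝ} (hB : ∀ y, ‖V y‖ ≤ B) (hdiv : VectorCalculus.IsDivFree V)
    (hpol : ∀ y, ⟪curl V y, EuclideanSpace.single 2 1⟫_ℝ = 0) {μ : ℝ} (hμ : 0 < μ)
    (hshear : ∀ y, ∀ b : Fin 3, b ≠ 2 →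
      fderiv ℝ V y (EuclideanSpace.single 2 1) b = μ * fderiv ℝ V y (EuclideanSpace.single b 1) 2) :
    ∀ x, V x = V 0 := by
  -- the rescalings `M = D c`, `N = D c⁻¹`, `c = √μ`
  set c : ℝ := Real.sqrt μ with hc
  have hcpos : 0 < c := Real.sqrt_pos.2 hμ
  have hc0 : c ≠ 0 := hcpos.ne'
  have hμc : μ = c ^ 2 := by rw [hc, Real.sq_sqrt hμ.le]
  set M : EuclideanSpace ℝ (Fin 3) →L[ℝ] EuclideanSpace ℝ (Fin 3) :=
    ContinuousLinearMap.id ℝ (EuclideanSpace ℝ (Fin 3)) +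
      (c - 1) • (EuclideanSpace.proj (2 : Fin 3) : EuclideanSpace ℝ (Fin 3) →L[ℝ] ℝ).smulRight
        (EuclideanSpace.single (2 : Fin 3) (1 : ℝ)) with hM
  set N : EuclideanSpace ℝ (Fin 3) →L[ℝ] EuclideanSpace ℝ (Fin 3) :=
    ContinuousLinearMap.id ℝ (EuclideanSpace ℝ (Fin 3)) +
      (c⁻¹ - 1) • (EuclideanSpace.proj (2 : Fin 3) : EuclideanSpace ℝ (Fin 3) →L[ℝ] ℝ).smulRight
        (EuclideanSpace.single (2 : Fin 3) (1 : ℝ)) with hN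
  have hNM : ∀ w, N (M w) = w := fun w => by simpa [hM, hN] using rescale_inv_apply hc0 w
  have hVd : Differentiable ℝ V := hV2.differentiable (by simp)
  -- the rescaled slice `ũ = M ∘ V ∘ N`
  have hu2 : ContDiff ℝ 2 (fun y : EuclideanSpace ℝ (Fin 3) => M (V (N y))) := M.contDiff.comp (hV2.comp N.contDiff)
  have hucurl : ∀ y, curl (fun y : EuclideanSpace ℝ (Fin 3) => M (V (N y))) y = 0 := by
    intro y
    have hp := hpol (N y)
    rw [EuclideanSpace.inner_single_right, one_mul, conj_trivial, curl_apply_two_eq, sub_eq_zero] at hp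
    simpa [hM, hN] using curl_rescale_eq_zero (V := V) hc0 hμc y (hVd _) (by simpa [hN] using hp)
      (by simpa [hN] using hshear (N y) 0 (by decide)) (by simpa [hN] using hshear (N y) 1 (by decide))
  have hudiv : VectorCalculus.IsDivFree (fun y : EuclideanSpace ℝ (Fin 3) => M (V (N y))) := by
    intro y
    simpa [hM, hN] using divergence_rescale_eq_zero (V := V) hc0 y (hVd _) (hdiv _)
  have hubdd : ∀ y, ‖M (V (N y))‖ ≤ ‖M‖ * B := fun y =>
    (M.le_opNorm _).trans (mul_le_mul_of_nonneg_left (hB _) (norm_nonneg _))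
  intro x
  have hMeq : M (V x) = M (V 0) := by
    have h := eq_of_curl_eq_zero_of_isDivFree_of_bounded hu2 hucurl hudiv hubdd (M x) 0
    simpa [hNM, map_zero] using h
  simpa [hNM] using congrArg N hMeq

/-- **CLASS: one slice with proportional shear of positive slope kills the profile.**  If one slice `s < 0` of a profile
of the route's Type-I class is poloidal along `e₃` and satisfies `∂₂v_b = μ ∂_b v₂` (`b = 0,1`) everywhere with `μ > 0`,
then `v ≡ 0`. -/
theorem eq_zero_of_proportionalShear_slice_pos (hrate : HasTypeITimeDecay C v)
    (hcont : ContinuousOn (uncurry v) (Iio (0 : ℝ) ×ˢ univ))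
    (hmild : ∀ s t : ℝ, s < t → t < 0 → ∀ x,
      v t x = UnboundedOperators.heatExtension (v s) (t - s) x - oseenDuhamel 1 s v v t x)
    (hdiv : ∀ t < 0, VectorCalculus.IsDivFree (v t)) {s : ℝ} (hs : s < 0)
    (hpol : ∀ y, ⟪curl (v s) y, EuclideanSpace.single 2 1⟫_ℝ = 0) {μ : ℝ} (hμ : 0 < μ)
    (hshear : ∀ y, ∀ b : Fin 3, b ≠ 2 →
      fderiv ℝ (v s) y (EuclideanSpace.single 2 1) b = μ * fderiv ℝ (v s) y (EuclideanSpace.single b 1) 2) :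
    ∀ t < 0, ∀ x, v t x = 0 := by
  have hC2 : ContDiff ℝ 2 (v s) := (analyticOnNhd_slice hcont (bdd_of_hasTypeITimeDecay hrate) hmild hs).contDiff
  have hconst : ∀ x, v s x = v s 0 :=
    slice_const_of_proportionalShear_pos hC2 (fun y => hrate s hs y) (hdiv s hs) hpol hμ hshear
  have hfun : v s = fun _ => v s 0 := funext hconst
  have hD : ∀ y ∈ (univ : Set (EuclideanSpace ℝ (Fin 3))),
      fderiv ℝ (v s) y (EuclideanSpace.single 0 (1 : ℝ)) = 0 := by
    intro y _
    rw [hfun]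
    simp
  have he : (EuclideanSpace.single 0 (1 : ℝ) : EuclideanSpace ℝ (Fin 3)) ≠ 0 := by
    intro h
    have := congrArg (fun w : EuclideanSpace ℝ (Fin 3) => w 0) h
    simp at this
  exact eq_zero_of_fderiv_apply_eq_zero_on_open hrate hcont hmild hdiv hs he isOpen_univ univ_nonempty hD

/-! ### Propagation of «time-only slope» from an open space–time set to every slice -/

/-- **THE MINORS VANISH ON EVERY SLICE.**  If on a nonempty open subset `W` of the backward slab the shear slope is a
function of time only, `∂₂v_b(s,y) = m(s) ∂_b v₂(s,y)` (`b = 0,1`), then for EVERY `s < 0`, all `y, y′ ∈ ℝ³` and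
`b, b′ ∈ {0,1}`: `∂₂v_b(s,y) · ∂_{b′}v₂(s,y′) = ∂₂v_{b′}(s,y′) · ∂_b v₂(s,y)` (the function of `(s, y, y′)` is jointly
real-analytic on the connected set `(−∞,0) × ℝ³ × ℝ³` and vanishes on the nonempty open set `{(s,y) ∈ W, (s,y′) ∈ W}`). -/
theorem shearMinor_eq_zero_of_local (hrate : HasTypeITimeDecay C v)
    (hcont : ContinuousOn (uncurry v) (Iio (0 : ℝ) ×ˢ univ))
    (hmild : ∀ s t : ℝ, s < t → t < 0 → ∀ x,
      v t x = UnboundedOperators.heatExtension (v s) (t - s) x - oseenDuhamel 1 s v v t x)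
    {W : Set (ℝ × EuclideanSpace ℝ (Fin 3))} (hW : IsOpen W) (hWne : W.Nonempty) (hWs : W ⊆ Iio (0 : ℝ) ×ˢ univ)
    {m : ℝ → ℝ}
    (h : ∀ z ∈ W, ∀ b : Fin 3, b ≠ 2 →
      fderiv ℝ (v z.1) z.2 (EuclideanSpace.single 2 1) b = m z.1 * fderiv ℝ (v z.1) z.2 (EuclideanSpace.single b 1) 2) :
    ∀ s < 0, ∀ (y y' : EuclideanSpace ℝ (Fin 3)) (b b' : Fin 3), b ≠ 2 → b' ≠ 2 →
      fderiv ℝ (v s) y (EuclideanSpace.single 2 1) b * fderiv ℝ (v s) y' (EuclideanSpace.single b' 1) 2 =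
        fderiv ℝ (v s) y' (EuclideanSpace.single 2 1) b' * fderiv ℝ (v s) y (EuclideanSpace.single b 1) 2 := by
  intro s hs y y' b b' hb hb'
  -- the doubled configuration space `P = (−∞,0) × (ℝ³ × ℝ³)` and the two projections to the slab
  set P : Set (ℝ × (EuclideanSpace ℝ (Fin 3) × EuclideanSpace ℝ (Fin 3))) := Iio (0 : ℝ) ×ˢ univ with hP
  set π₁ : ℝ × (EuclideanSpace ℝ (Fin 3) × EuclideanSpace ℝ (Fin 3)) → ℝ × EuclideanSpace ℝ (Fin 3) :=
    fun z => (z.1, z.2.1) with hπ₁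
  set π₂ : ℝ × (EuclideanSpace ℝ (Fin 3) × EuclideanSpace ℝ (Fin 3)) → ℝ × EuclideanSpace ℝ (Fin 3) :=
    fun z => (z.1, z.2.2) with hπ₂
  have hπ₁a : AnalyticOnNhd ℝ π₁ univ := fun z _ => analyticAt_fst.prod (analyticAt_fst.comp analyticAt_snd)
  have hπ₂a : AnalyticOnNhd ℝ π₂ univ := fun z _ => analyticAt_fst.prod (analyticAt_snd.comp analyticAt_snd)
  have hπ₁c : Continuous π₁ := continuous_fst.prodMk (continuous_fst.comp continuous_snd)
  have hπ₂c : Continuous π₂ := continuous_fst.prodMk (continuous_snd.comp continuous_snd)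
  have hπ₁m : MapsTo π₁ P (Iio (0 : ℝ) ×ˢ univ) := fun z hz => mk_mem_prod (mem_prod.1 hz).1 (mem_univ _)
  have hπ₂m : MapsTo π₂ P (Iio (0 : ℝ) ×ˢ univ) := fun z hz => mk_mem_prod (mem_prod.1 hz).1 (mem_univ _)
  -- the four Jacobian entries pulled back to `P`
  have hE : ∀ (j i : Fin 3) (π : ℝ × (EuclideanSpace ℝ (Fin 3) × EuclideanSpace ℝ (Fin 3)) → ℝ × EuclideanSpace ℝ (Fin 3)),
      AnalyticOnNhd ℝ π univ → MapsTo π P (Iio (0 : ℝ) ×ˢ univ) →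
      AnalyticOnNhd ℝ (fun z => fderiv ℝ (v (π z).1) (π z).2 (EuclideanSpace.single j 1) i) P := by
    intro j i π hπ hπm
    have hc := (analyticOnNhd_uncurry_fderiv_entry hrate hcont hmild j i).comp (hπ.mono (subset_univ P)) hπm
    exact hc
  -- the minor as a jointly analytic function on `P`
  set G : ℝ × (EuclideanSpace ℝ (Fin 3) × EuclideanSpace ℝ (Fin 3)) → ℝ := fun z =>
    fderiv ℝ (v (π₁ z).1) (π₁ z).2 (EuclideanSpace.single 2 1) b *
        fderiv ℝ (v (π₂ z).1) (π₂ z).2 (EuclideanSpace.single b' 1) 2 -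
      fderiv ℝ (v (π₂ z).1) (π₂ z).2 (EuclideanSpace.single 2 1) b' *
        fderiv ℝ (v (π₁ z).1) (π₁ z).2 (EuclideanSpace.single b 1) 2 with hG
  have hGa : AnalyticOnNhd ℝ G P :=
    ((hE 2 b π₁ hπ₁a hπ₁m).mul (hE b' 2 π₂ hπ₂a hπ₂m)).sub ((hE 2 b' π₂ hπ₂a hπ₂m).mul (hE b 2 π₁ hπ₁a hπ₁m))
  -- `G` vanishes on the nonempty open set `π₁⁻¹ W ∩ π₂⁻¹ W`
  obtain ⟨z₀, hz₀⟩ := hWne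
  set z₁ : ℝ × (EuclideanSpace ℝ (Fin 3) × EuclideanSpace ℝ (Fin 3)) := (z₀.1, (z₀.2, z₀.2)) with hz₁
  have hz₁P : z₁ ∈ P := mk_mem_prod (mem_prod.1 (hWs hz₀)).1 (mem_univ _)
  have hopen : IsOpen (π₁ ⁻¹' W ∩ π₂ ⁻¹' W) := (hW.preimage hπ₁c).inter (hW.preimage hπ₂c)
  have hz₁W : z₁ ∈ π₁ ⁻¹' W ∩ π₂ ⁻¹' W := ⟨by simpa [hπ₁, hz₁] using hz₀, by simpa [hπ₂, hz₁] using hz₀⟩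
  have hev : G =ᶠ[𝓝 z₁] 0 := by
    filter_upwards [hopen.mem_nhds hz₁W] with z hz
    obtain ⟨h1, h2⟩ := hz
    show fderiv ℝ (v (π₁ z).1) (π₁ z).2 (EuclideanSpace.single 2 1) b *
        fderiv ℝ (v (π₂ z).1) (π₂ z).2 (EuclideanSpace.single b' 1) 2 -
      fderiv ℝ (v (π₂ z).1) (π₂ z).2 (EuclideanSpace.single 2 1) b' *
        fderiv ℝ (v (π₁ z).1) (π₁ z).2 (EuclideanSpace.single b 1) 2 = 0
    rw [h (π₁ z) h1 b hb, h (π₂ z) h2 b' hb']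
    simp only [hπ₁, hπ₂]
    ring
  have hpre : IsPreconnected P :=
    ((convex_Iio (0 : ℝ)).prod (convex_univ :
      Convex ℝ (univ : Set (EuclideanSpace ℝ (Fin 3) × EuclideanSpace ℝ (Fin 3))))).isPreconnected
  have hzero := hGa.eqOn_zero_of_preconnected_of_eventuallyEq_zero hpre hz₁P hev
  have hmem : ((s, (y, y')) : ℝ × (EuclideanSpace ℝ (Fin 3) × EuclideanSpace ℝ (Fin 3))) ∈ P :=
    mk_mem_prod hs (mem_univ _)
  have := hzero hmem
  simpa [hG, hπ₁, hπ₂, sub_eq_zero] using this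

/-- **Vanishing minors on a slice ⇒ flat or proportional-shear.**  Pointwise algebra: if all the minors
`∂₂V_b(y) ∂_{b′}V₂(y′) − ∂₂V_{b′}(y′) ∂_b V₂(y)` vanish (`b, b′ ∈ {0,1}`), then either `∇_h V₂ ≡ 0` or there is ONE real
`μ` with `∂₂V_b ≡ μ ∂_b V₂` (`b = 0,1`). -/
theorem proportionalShear_or_flat_of_minor {V : EuclideanSpace ℝ (Fin 3) → EuclideanSpace ℝ (Fin 3)}
    (h : ∀ (y y' : EuclideanSpace ℝ (Fin 3)) (b b' : Fin 3), b ≠ 2 → b' ≠ 2 →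
      fderiv ℝ V y (EuclideanSpace.single 2 1) b * fderiv ℝ V y' (EuclideanSpace.single b' 1) 2 =
        fderiv ℝ V y' (EuclideanSpace.single 2 1) b' * fderiv ℝ V y (EuclideanSpace.single b 1) 2) :
    (∀ y, fderiv ℝ V y (EuclideanSpace.single 0 1) 2 = 0 ∧ fderiv ℝ V y (EuclideanSpace.single 1 1) 2 = 0) ∨
      ∃ μ : ℝ, ∀ y, ∀ b : Fin 3, b ≠ 2 →
        fderiv ℝ V y (EuclideanSpace.single 2 1) b = μ * fderiv ℝ V y (EuclideanSpace.single b 1) 2 := by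
  by_cases hex : ∃ (y' : EuclideanSpace ℝ (Fin 3)) (b' : Fin 3), b' ≠ 2 ∧ fderiv ℝ V y' (EuclideanSpace.single b' 1) 2 ≠ 0
  · obtain ⟨y', b', hb', hne⟩ := hex
    refine Or.inr ⟨fderiv ℝ V y' (EuclideanSpace.single 2 1) b' / fderiv ℝ V y' (EuclideanSpace.single b' 1) 2,
      fun y b hb => ?_⟩
    have key := h y y' b b' hb hb'
    rw [div_mul_eq_mul_div, eq_div_iff hne]
    linear_combination key
  · push Not at hex
    exact Or.inl fun y => ⟨hex y 0 (by decide), hex y 1 (by decide)⟩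

/-! ### The reduction to time-dependent proportional shear on every slice -/

/-- **THE REDUCTION.**  Let `v` be a profile of the route's Type-I class, poloidal along `e₃` on every slice, whose shear
slope is a function of time only on some nonempty open space–time subset `W` of the backward slab:
`∂₂v_b(s,y) = m(s) ∂_b v₂(s,y)` for `(s,y) ∈ W`, `b = 0,1`.  Then EITHER `v ≡ 0` OR every slice `s < 0` is
proportional-shear with its own NEGATIVE slope: `∃ μ_s < 0`, `∂₂v_b(s,·) ≡ μ_s ∂_b v₂(s,·)` (`b = 0,1`). -/
theorem timeShear_of_local (hrate : HasTypeITimeDecay C v)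
    (hcont : ContinuousOn (uncurry v) (Iio (0 : ℝ) ×ˢ univ))
    (hmild : ∀ s t : ℝ, s < t → t < 0 → ∀ x,
      v t x = UnboundedOperators.heatExtension (v s) (t - s) x - oseenDuhamel 1 s v v t x)
    (hdiv : ∀ t < 0, VectorCalculus.IsDivFree (v t))
    (hpol : ∀ s < 0, ∀ y, ⟪curl (v s) y, EuclideanSpace.single 2 1⟫_ℝ = 0)
    {W : Set (ℝ × EuclideanSpace ℝ (Fin 3))} (hW : IsOpen W) (hWne : W.Nonempty) (hWs : W ⊆ Iio (0 : ℝ) ×ˢ univ)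
    {m : ℝ → ℝ}
    (h : ∀ z ∈ W, ∀ b : Fin 3, b ≠ 2 →
      fderiv ℝ (v z.1) z.2 (EuclideanSpace.single 2 1) b = m z.1 * fderiv ℝ (v z.1) z.2 (EuclideanSpace.single b 1) 2) :
    (∀ t < 0, ∀ x, v t x = 0) ∨
      ∀ s < 0, ∃ μ : ℝ, μ < 0 ∧ ∀ y, ∀ b : Fin 3, b ≠ 2 →
        fderiv ℝ (v s) y (EuclideanSpace.single 2 1) b = μ * fderiv ℝ (v s) y (EuclideanSpace.single b 1) 2 := by
  by_cases hv : ∀ t < 0, ∀ x, v t x = 0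
  · exact Or.inl hv
  · refine Or.inr fun s hs => ?_
    have hmin := shearMinor_eq_zero_of_local hrate hcont hmild hW hWne hWs h s hs
    rcases proportionalShear_or_flat_of_minor (V := v s) hmin with hflat | ⟨μ, hμ⟩
    · -- a horizontally flat slice: nsreg-p7's flat germ (Λ = 0)
      exact absurd (eq_zero_of_horizontalGradient_eq_zero_on_open hrate hcont hmild hdiv hs (hpol s hs) isOpen_univ
        univ_nonempty fun y _ => (hflat y).1) hv
    · rcases lt_trichotomy μ 0 with hneg | rfl | hpos
      · exact ⟨μ, hneg, hμ⟩
      · -- slope `0`: the vertically rigid germ (Λ = 1)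
        exact absurd (eq_zero_of_verticalShear_eq_zero_on_open hrate hcont hmild hdiv hs isOpen_univ univ_nonempty
          fun y _ => ⟨by simpa using hμ y 0 (by decide), by simpa using hμ y 1 (by decide)⟩) hv
      · -- positive slope: the kinematic rescaling
        exact absurd (eq_zero_of_proportionalShear_slice_pos hrate hcont hmild hdiv hs (hpol s hs) hpos hμ) hv

/-- **Analyticity of the slope in time.**  In the situation of `timeShear_of_local`'s second alternative, let
`μ : ℝ → ℝ` be ANY choice of the slopes (`∂₂v_b(s,·) ≡ μ(s) ∂_b v₂(s,·)` for all `s < 0`).  If the slice `s₀ < 0` carries a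
point `y₀` and an index `b₀ ∈ {0,1}` with `∂_{b₀}v₂(s₀,y₀) ≠ 0`, then `μ` is real-analytic at `s₀` (near `s₀` it is the ratio
`∂₂v_{b₀}(s,y₀)/∂_{b₀}v₂(s,y₀)` of two functions analytic in `s`). -/
theorem analyticAt_sliceSlope (hrate : HasTypeITimeDecay C v)
    (hcont : ContinuousOn (uncurry v) (Iio (0 : ℝ) ×ˢ univ))
    (hmild : ∀ s t : ℝ, s < t → t < 0 → ∀ x,
      v t x = UnboundedOperators.heatExtension (v s) (t - s) x - oseenDuhamel 1 s v v t x)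
    {μ : ℝ → ℝ}
    (hμ : ∀ s < 0, ∀ y, ∀ b : Fin 3, b ≠ 2 →
      fderiv ℝ (v s) y (EuclideanSpace.single 2 1) b = μ s * fderiv ℝ (v s) y (EuclideanSpace.single b 1) 2)
    {s₀ : ℝ} (hs₀ : s₀ < 0) {y₀ : EuclideanSpace ℝ (Fin 3)} {b₀ : Fin 3} (hb₀ : b₀ ≠ 2)
    (hne : fderiv ℝ (v s₀) y₀ (EuclideanSpace.single b₀ 1) 2 ≠ 0) :
    AnalyticAt ℝ μ s₀ := by
  -- the two entries along the time line `s ↦ (s, y₀)`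
  have hline : AnalyticAt ℝ (fun s : ℝ => ((s, y₀) : ℝ × EuclideanSpace ℝ (Fin 3))) s₀ :=
    analyticAt_id.prod analyticAt_const
  have hmem : ((s₀, y₀) : ℝ × EuclideanSpace ℝ (Fin 3)) ∈ Iio (0 : ℝ) ×ˢ (univ : Set (EuclideanSpace ℝ (Fin 3))) :=
    mk_mem_prod hs₀ (mem_univ _)
  have hA : AnalyticAt ℝ (fun s : ℝ => fderiv ℝ (v s) y₀ (EuclideanSpace.single 2 1) b₀) s₀ := by
    have h := (analyticOnNhd_uncurry_fderiv_entry hrate hcont hmild 2 b₀ (s₀, y₀) hmem).comp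
      (f := fun s : ℝ => ((s, y₀) : ℝ × EuclideanSpace ℝ (Fin 3))) hline
    simpa [Function.comp_def] using h
  have ha : AnalyticAt ℝ (fun s : ℝ => fderiv ℝ (v s) y₀ (EuclideanSpace.single b₀ 1) 2) s₀ := by
    have h := (analyticOnNhd_uncurry_fderiv_entry hrate hcont hmild b₀ 2 (s₀, y₀) hmem).comp
      (f := fun s : ℝ => ((s, y₀) : ℝ × EuclideanSpace ℝ (Fin 3))) hline
    simpa [Function.comp_def] using h
  -- near `s₀` the denominator does not vanish and `μ` is the ratio
  have hne' : ∀ᶠ s in 𝓝 s₀, fderiv ℝ (v s) y₀ (EuclideanSpace.single b₀ 1) 2 ≠ 0 :=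
    ha.continuousAt.eventually_ne hne
  have hneg : ∀ᶠ s in 𝓝 s₀, s < 0 := Iio_mem_nhds hs₀
  have hev : μ =ᶠ[𝓝 s₀] fun s =>
      fderiv ℝ (v s) y₀ (EuclideanSpace.single 2 1) b₀ / fderiv ℝ (v s) y₀ (EuclideanSpace.single b₀ 1) 2 := by
    filter_upwards [hne', hneg] with s hs1 hs2
    rw [hμ s hs2 y₀ b₀ hb₀, mul_div_cancel_right₀ _ hs1]
  exact (hA.div ha hne).congr hev.symm

/-- **If the slopes are one constant, K2-p2's theorem ends.**  Class + poloidal + time-only slope on a nonempty open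
space–time set + «all the slopes `μ_s` of the slices coincide» ⇒ not backward-singular.  Spelled without a slope function:
it suffices that ONE real `μ` serves every slice. -/
theorem nonflatLiouville_of_local_timeShear_of_const (hrate : HasTypeITimeDecay C v)
    (hcont : ContinuousOn (uncurry v) (Iio (0 : ℝ) ×ˢ univ))
    (hmild : ∀ s t : ℝ, s < t → t < 0 → ∀ x,
      v t x = UnboundedOperators.heatExtension (v s) (t - s) x - oseenDuhamel 1 s v v t x)
    (hdiv : ∀ t < 0, VectorCalculus.IsDivFree (v t))
    (hpol : ∀ s < 0, ∀ y, ⟪curl (v s) y, EuclideanSpace.single 2 1⟫_ℝ = 0)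
    {μ : ℝ}
    (hconst : ∀ s < 0, ∀ μ' : ℝ, (∀ y, ∀ b : Fin 3, b ≠ 2 →
        fderiv ℝ (v s) y (EuclideanSpace.single 2 1) b = μ' * fderiv ℝ (v s) y (EuclideanSpace.single b 1) 2) →
      (∀ y, ∀ b : Fin 3, b ≠ 2 →
        fderiv ℝ (v s) y (EuclideanSpace.single 2 1) b = μ * fderiv ℝ (v s) y (EuclideanSpace.single b 1) 2))
    {W : Set (ℝ × EuclideanSpace ℝ (Fin 3))} (hW : IsOpen W) (hWne : W.Nonempty) (hWs : W ⊆ Iio (0 : ℝ) ×ˢ univ)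
    {m : ℝ → ℝ}
    (h : ∀ z ∈ W, ∀ b : Fin 3, b ≠ 2 →
      fderiv ℝ (v z.1) z.2 (EuclideanSpace.single 2 1) b = m z.1 * fderiv ℝ (v z.1) z.2 (EuclideanSpace.single b 1) 2) :
    ¬ IsBackwardSingularPoint v 0 := by
  rcases timeShear_of_local hrate hcont hmild hdiv hpol hW hWne hWs h with hzero | hall
  · exact not_backwardSingular_of_zero hzero
  · refine nonflatLiouville_of_constantShear_real hrate hcont hmild hdiv hpol μ fun s hs => ?_
    obtain ⟨μ', -, hμ'⟩ := hall s hs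
    exact hconst s hs μ' hμ'

end Summit.NavierStokesRegularity.NavierStokesRegularity.Theorems.PoloidalWindowDoorPoloidalWindowRigidityTimeShear

end
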